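import Mathlib
import Summits.Ventures.PercRepro2.HCov
import Summits.Ventures.PercRepro2.RootLeafUPocketGraph
import Summits.Ventures.PercRepro2.RootLeafUPocketShare
import Summits.Ventures.PercRepro2.RootLeafUPocket3Graph
import Summits.Ventures.PercRepro2.RootLeafUPocket3Sep

/-!
# The boundary-`{u, a₂, c}` pocket at `b`: the `T′`-world factorisations (blind cell PercRepro2,
p4 g18; S3 (G4-u) item (ae), proofs/P4-G18-PDTHRESHOLD.md §6; no definitions)

On `T′ = {u ↮ a₂, c ∈ L}` the pocket part may join `c` to `u` (the type `W₁cu`), so `T′` splits into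
two pieces: the outside is in `T′₀` and the pocket part only keeps `u, c` out of `a₂`'s block (`W₁`), or
the outside is in `PD₀` and the pocket part joins `c ~ u` (`W₁cu`):

* `Tp_eq`: `T′ = ({off ∈ T′} ∩ {inn ∈ W₁}) ∪ ({off ∈ PD} ∩ {inn ∈ W₁cu})` (a disjoint union);
* on `T′`: `o ∈ K` is the outside event `a₂ ↔ o` (`Tp_oK_iff`), `b ∈ K` the pocket event `a₂ ~ b`
  (`Tp_bK_iff`), `b ∈ L` the pocket event `u ~ b ∨ c ~ b` (`Tp_bL_iff`);
* the refined events as `T′ ∩ ({off ∈ A} ∩ {inn ∈ B})` (`Tp_oK_eq`, `Tp_bK_eq`, `Tp_bL_eq`, `Tp_oK_bK_eq`,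
  `Tp_oK_bL_eq`) and the split of such an intersection into the two pieces (`Tp_inter_eq`, disjoint by
  `Tp_pieces_disjoint`).

The six `T′` masses are in RootLeafUPocket3TpMass; with RootLeafUPocket3Sep these are the twelve
factorisations of the pocket (K) identity.
-/

namespace Summit.Ventures.PercRepro2

open UnionCluster

namespace RootLeafU

namespace Pocket3

variable {V : Type*} {E : Type*}

section Tp

variable {ends : E → Sym2 V} {P : Set V} {u a₂ c b : V} {off inn : Config E → Config E}

/-- Membership in `T′ = {u ↮ a₂, c ∈ L}` (`TEvent ends a₂ u c`). -/
lemma mem_TpEvent_iff {ω : Config E} :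
    ω ∈ TEvent ends a₂ u c ↔ ¬ Conn ends ω u a₂ ∧ Conn ends ω u c := by
  simp only [TEvent, Set.mem_inter_iff, Set.mem_compl_iff, mem_connEvent]

/-- With `u, c` out of `a₂`'s pocket block, a pocket join between two terminals is trivial or the
join `u ~ c`. -/
lemma excursion_cases {ω : Config E}
    (hW : ¬ Conn ends (inn ω) u a₂ ∧ ¬ Conn ends (inn ω) c a₂)
    {s t : V} (hs : s = u ∨ s = a₂ ∨ s = c) (ht : t = u ∨ t = a₂ ∨ t = c)
    (h : Conn ends (inn ω) s t) : s = t ∨ (s = u ∧ t = c) ∨ (s = c ∧ t = u) := by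
  obtain ⟨h1, h2⟩ := hW
  rcases hs with rfl | rfl | rfl <;> rcases ht with rfl | rfl | rfl
  · exact Or.inl rfl
  · exact absurd h h1
  · exact Or.inr (Or.inl ⟨rfl, rfl⟩)
  · exact absurd (conn_symm h) h1
  · exact Or.inl rfl
  · exact absurd (conn_symm h) h2
  · exact Or.inr (Or.inr ⟨rfl, rfl⟩)
  · exact absurd h h2
  · exact Or.inl rfl

/-- **`T′` factorises** into two disjoint pieces. -/
theorem Tp_eq (hP : ∀ e y z, ends e = s(y, z) → y ∈ P → z ∈ P ∨ z = u ∨ z = a₂ ∨ z = c)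
    (hoff : (∀ ω e, e ∈ touches ends P → off ω e = false) ∧ (∀ ω e, e ∉ touches ends P → off ω e = ω e))
    (hinn : (∀ ω e, e ∈ touches ends P → inn ω e = ω e) ∧ (∀ ω e, e ∉ touches ends P → inn ω e = false))
    (hu : u ∉ P) (ha : a₂ ∉ P) (hc : c ∉ P) :
    TEvent ends a₂ u c =
      ({ω : Config E | off ω ∈ TEvent ends a₂ u c} ∩
        {ω : Config E | ¬ Conn ends (inn ω) u a₂ ∧ ¬ Conn ends (inn ω) c a₂}) ∪
      ({ω : Config E | off ω ∈ PDEvent ends u a₂ c} ∩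
        {ω : Config E | (¬ Conn ends (inn ω) u a₂ ∧ ¬ Conn ends (inn ω) c a₂) ∧ Conn ends (inn ω) c u}) := by
  ext ω
  simp only [Set.mem_union, Set.mem_inter_iff, Set.mem_setOf_eq, mem_TpEvent_iff, mem_PDEvent_iff]
  constructor
  · rintro ⟨hQ, huc⟩
    have hca : ¬ Conn ends ω c a₂ := fun h => hQ (conn_trans huc h)
    have hW : ¬ Conn ends (inn ω) u a₂ ∧ ¬ Conn ends (inn ω) c a₂ :=
      ⟨fun h => hQ (conn_mono (Pocket.inn_le hinn ω) h), fun h => hca (conn_mono (Pocket.inn_le hinn ω) h)⟩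
    have hQo : ¬ Conn ends (off ω) u a₂ := fun h => hQ (conn_mono (Pocket.off_le hoff ω) h)
    have hcao : ¬ Conn ends (off ω) c a₂ := fun h => hca (conn_mono (Pocket.off_le hoff ω) h)
    by_cases huco : Conn ends (off ω) u c
    · exact Or.inl ⟨⟨hQo, huco⟩, hW⟩
    · -- `u ↔ c` needs the pocket: the join `u ~ c` in the pocket part
      rcases (conn_iff_off_or_excursion hP hoff hinn hu hc).1 huc with h | ⟨s, t, hTs, hTt, hus, hst, htc⟩
      · exact absurd h huco
      · rcases excursion_cases hW hTs hTt hst with h | ⟨h1, h2⟩ | ⟨h1, h2⟩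
        · rw [h] at hus
          exact absurd (conn_trans hus htc) huco
        · rw [h1, h2] at hst
          exact Or.inr ⟨⟨hQo, fun h => huco (conn_symm h), hcao⟩, hW, conn_symm hst⟩
        · rw [h1] at hus
          exact absurd hus huco
  · -- both pieces lie in `T′`: no route from `u` to `a₂`, and `u ↔ c` outside or in the pocket
    have noQ : ∀ ω' : Config E, ¬ Conn ends (off ω') u a₂ → ¬ Conn ends (off ω') c a₂ →
        (¬ Conn ends (inn ω') u a₂ ∧ ¬ Conn ends (inn ω') c a₂) → ¬ Conn ends ω' u a₂ := by
      intro ω' h1 h2 hW h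
      rcases (conn_iff_off_or_excursion hP hoff hinn hu ha).1 h with h' | ⟨s, t, hTs, hTt, hus, hst, hta⟩
      · exact h1 h'
      · rcases excursion_cases hW hTs hTt hst with h | ⟨h1', h2'⟩ | ⟨h1', h2'⟩
        · rw [h] at hus
          exact h1 (conn_trans hus hta)
        · rw [h2'] at hta
          exact h2 hta
        · rw [h2'] at hta
          exact h1 hta
    rintro (⟨⟨h1, huc⟩, hW⟩ | ⟨⟨h1, h2, h3⟩, hW, hcu⟩)
    · exact ⟨noQ ω h1 (fun h => h1 (conn_trans huc h)) hW, conn_mono (Pocket.off_le hoff ω) huc⟩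
    · exact ⟨noQ ω h1 h3 hW, conn_mono (Pocket.inn_le hinn ω) (conn_symm hcu)⟩

/-- On `T′`, `o ∈ K` (for `o ∉ P`) is the outside event `a₂ ↔ o`. -/
lemma Tp_oK_iff (hP : ∀ e y z, ends e = s(y, z) → y ∈ P → z ∈ P ∨ z = u ∨ z = a₂ ∨ z = c)
    (hoff : (∀ ω e, e ∈ touches ends P → off ω e = false) ∧ (∀ ω e, e ∉ touches ends P → off ω e = ω e))
    (hinn : (∀ ω e, e ∈ touches ends P → inn ω e = ω e) ∧ (∀ ω e, e ∉ touches ends P → inn ω e = false))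
    (ha : a₂ ∉ P) {o : V} (ho : o ∉ P) {ω : Config E} (hT : ω ∈ TEvent ends a₂ u c) :
    Conn ends ω a₂ o ↔ Conn ends (off ω) a₂ o := by
  obtain ⟨hQ, huc⟩ := mem_TpEvent_iff.1 hT
  have hca : ¬ Conn ends ω c a₂ := fun h => hQ (conn_trans huc h)
  have hW : ¬ Conn ends (inn ω) u a₂ ∧ ¬ Conn ends (inn ω) c a₂ :=
    ⟨fun h => hQ (conn_mono (Pocket.inn_le hinn ω) h), fun h => hca (conn_mono (Pocket.inn_le hinn ω) h)⟩
  constructor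
  · intro h
    rcases (conn_iff_off_or_excursion hP hoff hinn ha ho).1 h with h' | ⟨s, t, hTs, hTt, has, hst, hto⟩
    · exact h'
    · rcases excursion_cases hW hTs hTt hst with h | ⟨h1, h2⟩ | ⟨h1, h2⟩
      · rw [h] at has
        exact conn_trans has hto
      · rw [h1] at has
        exact absurd (conn_mono (Pocket.off_le hoff ω) has) (fun h => hQ (conn_symm h))
      · rw [h1] at has
        exact absurd (conn_symm (conn_mono (Pocket.off_le hoff ω) has)) hca
  · exact conn_mono (Pocket.off_le hoff ω)

/-- On `T′`, `b ∈ K` is the pocket event `a₂ ~ b`. -/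
lemma Tp_bK_iff (hP : ∀ e y z, ends e = s(y, z) → y ∈ P → z ∈ P ∨ z = u ∨ z = a₂ ∨ z = c)
    (hoff : (∀ ω e, e ∈ touches ends P → off ω e = false) ∧ (∀ ω e, e ∉ touches ends P → off ω e = ω e))
    (hinn : (∀ ω e, e ∈ touches ends P → inn ω e = ω e) ∧ (∀ ω e, e ∉ touches ends P → inn ω e = false))
    (ha : a₂ ∉ P) (hb : b ∈ P) {ω : Config E} (hT : ω ∈ TEvent ends a₂ u c) :
    Conn ends ω a₂ b ↔ Conn ends (inn ω) a₂ b := by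
  obtain ⟨hQ, huc⟩ := mem_TpEvent_iff.1 hT
  have hca : ¬ Conn ends ω c a₂ := fun h => hQ (conn_trans huc h)
  have hW : ¬ Conn ends (inn ω) u a₂ ∧ ¬ Conn ends (inn ω) c a₂ :=
    ⟨fun h => hQ (conn_mono (Pocket.inn_le hinn ω) h), fun h => hca (conn_mono (Pocket.inn_le hinn ω) h)⟩
  have hoffa : ∀ s, (s = u ∨ s = a₂ ∨ s = c) → Conn ends (off ω) a₂ s → s = a₂ := by
    intro s hs h
    rcases hs with rfl | rfl | rfl
    · exact absurd (conn_mono (Pocket.off_le hoff ω) h) (fun h => hQ (conn_symm h))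
    · rfl
    · exact absurd (conn_mono (Pocket.off_le hoff ω) h) (fun h => hca (conn_symm h))
  constructor
  · intro h
    obtain ⟨s, hTs, hM, hsb⟩ := (conn_pocket_iff hP hoff hinn ha hb).1 h
    rcases hM with h' | ⟨s', t', hTs', hTt', has', hs't', ht's⟩
    · have e := hoffa s hTs h'
      subst e
      exact hsb
    · have e1 := hoffa s' hTs' has'
      rw [e1] at hs't' hTs'
      rcases excursion_cases hW hTs' hTt' hs't' with h | ⟨h1, _⟩ | ⟨h1, _⟩
      · rw [← h] at ht's
        have e2 := hoffa s hTs ht's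
        subst e2
        exact hsb
      · exfalso
        apply hW.1
        rw [h1]
        exact conn_refl _ _ _
      · exfalso
        apply hW.2
        rw [h1]
        exact conn_refl _ _ _
  · exact conn_mono (Pocket.inn_le hinn ω)

/-- On `T′`, `b ∈ L` is the pocket event `u ~ b ∨ c ~ b`. -/
lemma Tp_bL_iff (hP : ∀ e y z, ends e = s(y, z) → y ∈ P → z ∈ P ∨ z = u ∨ z = a₂ ∨ z = c)
    (hoff : (∀ ω e, e ∈ touches ends P → off ω e = false) ∧ (∀ ω e, e ∉ touches ends P → off ω e = ω e))
    (hinn : (∀ ω e, e ∈ touches ends P → inn ω e = ω e) ∧ (∀ ω e, e ∉ touches ends P → inn ω e = false))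
    (hu : u ∉ P) (hc : c ∉ P) (hb : b ∈ P) {ω : Config E} (hT : ω ∈ TEvent ends a₂ u c) :
    Conn ends ω u b ↔ Conn ends (inn ω) u b ∨ Conn ends (inn ω) c b := by
  obtain ⟨hQ, huc⟩ := mem_TpEvent_iff.1 hT
  have hca : ¬ Conn ends ω c a₂ := fun h => hQ (conn_trans huc h)
  constructor
  · intro h
    obtain ⟨s, hTs, hM, hsb⟩ := (conn_pocket_iff hP hoff hinn hu hb).1 h
    -- the terminal `s` is reached from `u` in `G`, so `s ≠ a₂`: `s = u` or `s = c`
    have hus : Conn ends ω u s := by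
      rcases hM with h' | ⟨s', t', _, _, hus', hs't', ht's⟩
      · exact conn_mono (Pocket.off_le hoff ω) h'
      · exact conn_trans (conn_mono (Pocket.off_le hoff ω) hus')
          (conn_trans (conn_mono (Pocket.inn_le hinn ω) hs't') (conn_mono (Pocket.off_le hoff ω) ht's))
    rcases hTs with rfl | rfl | rfl
    · exact Or.inl hsb
    · exact absurd hus hQ
    · exact Or.inr hsb
  · rintro (h | h)
    · exact conn_mono (Pocket.inn_le hinn ω) h
    · exact conn_trans huc (conn_mono (Pocket.inn_le hinn ω) h)

/-- `T′ ∩ ({off ∈ A} ∩ {inn ∈ B})` splits into the two pieces (set algebra on `Tp_eq`). -/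
theorem Tp_inter_eq (hP : ∀ e y z, ends e = s(y, z) → y ∈ P → z ∈ P ∨ z = u ∨ z = a₂ ∨ z = c)
    (hoff : (∀ ω e, e ∈ touches ends P → off ω e = false) ∧ (∀ ω e, e ∉ touches ends P → off ω e = ω e))
    (hinn : (∀ ω e, e ∈ touches ends P → inn ω e = ω e) ∧ (∀ ω e, e ∉ touches ends P → inn ω e = false))
    (hu : u ∉ P) (ha : a₂ ∉ P) (hc : c ∉ P) (A B : Set (Config E)) :
    TEvent ends a₂ u c ∩ ({ω : Config E | off ω ∈ A} ∩ {ω : Config E | inn ω ∈ B}) =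
      ({ω : Config E | off ω ∈ TEvent ends a₂ u c ∩ A} ∩
        {ω : Config E | inn ω ∈ {ω' : Config E | ¬ Conn ends ω' u a₂ ∧ ¬ Conn ends ω' c a₂} ∩ B}) ∪
      ({ω : Config E | off ω ∈ PDEvent ends u a₂ c ∩ A} ∩
        {ω : Config E | inn ω ∈ {ω' : Config E | (¬ Conn ends ω' u a₂ ∧ ¬ Conn ends ω' c a₂) ∧ Conn ends ω' c u} ∩ B}) := by
  ext ω
  have h := Set.ext_iff.1 (Tp_eq hP hoff hinn hu ha hc) ω
  simp only [Set.mem_union, Set.mem_inter_iff, Set.mem_setOf_eq] at h ⊢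
  rw [h]
  tauto

/-- The two pieces of `T′` are disjoint (`c ↔ u` outside in the first, `c ↮ u` outside in the second). -/
lemma Tp_pieces_disjoint (A B : Set (Config E)) :
    Disjoint ({ω : Config E | off ω ∈ TEvent ends a₂ u c ∩ A} ∩
        {ω : Config E | inn ω ∈ {ω' : Config E | ¬ Conn ends ω' u a₂ ∧ ¬ Conn ends ω' c a₂} ∩ B})
      ({ω : Config E | off ω ∈ PDEvent ends u a₂ c ∩ A} ∩
        {ω : Config E | inn ω ∈ {ω' : Config E | (¬ Conn ends ω' u a₂ ∧ ¬ Conn ends ω' c a₂) ∧ Conn ends ω' c u} ∩ B}) := by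
  rw [Set.disjoint_left]
  rintro ω ⟨⟨hT, _⟩, _⟩ ⟨⟨hPD, _⟩, _⟩
  exact (mem_PDEvent_iff.1 hPD).2.1 (conn_symm (mem_TpEvent_iff.1 hT).2)

/-- `T′` as `T′ ∩ (univ-off ∩ univ-inn)`, for the split. -/
lemma Tp_eq_inter_univ : TEvent ends a₂ u c =
    TEvent ends a₂ u c ∩ ({ω : Config E | off ω ∈ Set.univ} ∩ {ω : Config E | inn ω ∈ Set.univ}) := by
  ext ω; simp

/-- `T′ ∩ {o ∈ K} = T′ ∩ {off ∈ {a₂ ↔ o}} ∩ {inn ∈ univ}` (`o ∉ P`). -/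
lemma Tp_oK_eq (hP : ∀ e y z, ends e = s(y, z) → y ∈ P → z ∈ P ∨ z = u ∨ z = a₂ ∨ z = c)
    (hoff : (∀ ω e, e ∈ touches ends P → off ω e = false) ∧ (∀ ω e, e ∉ touches ends P → off ω e = ω e))
    (hinn : (∀ ω e, e ∈ touches ends P → inn ω e = ω e) ∧ (∀ ω e, e ∉ touches ends P → inn ω e = false))
    (ha : a₂ ∉ P) {o : V} (ho : o ∉ P) :
    TEvent ends a₂ u c ∩ connEvent ends a₂ o =
      TEvent ends a₂ u c ∩ ({ω : Config E | off ω ∈ connEvent ends a₂ o} ∩ {ω : Config E | inn ω ∈ Set.univ}) := by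
  ext ω
  simp only [Set.mem_inter_iff, Set.mem_setOf_eq, mem_connEvent, Set.mem_univ, and_true]
  constructor
  · rintro ⟨hT, h⟩; exact ⟨hT, (Tp_oK_iff hP hoff hinn ha ho hT).1 h⟩
  · rintro ⟨hT, h⟩; exact ⟨hT, (Tp_oK_iff hP hoff hinn ha ho hT).2 h⟩

/-- `T′ ∩ {b ∈ K} = T′ ∩ {off ∈ univ} ∩ {inn ∈ {a₂ ~ b}}`. -/
lemma Tp_bK_eq (hP : ∀ e y z, ends e = s(y, z) → y ∈ P → z ∈ P ∨ z = u ∨ z = a₂ ∨ z = c)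
    (hoff : (∀ ω e, e ∈ touches ends P → off ω e = false) ∧ (∀ ω e, e ∉ touches ends P → off ω e = ω e))
    (hinn : (∀ ω e, e ∈ touches ends P → inn ω e = ω e) ∧ (∀ ω e, e ∉ touches ends P → inn ω e = false))
    (ha : a₂ ∉ P) (hb : b ∈ P) :
    TEvent ends a₂ u c ∩ connEvent ends a₂ b =
      TEvent ends a₂ u c ∩ ({ω : Config E | off ω ∈ Set.univ} ∩ {ω : Config E | inn ω ∈ connEvent ends a₂ b}) := by
  ext ω
  simp only [Set.mem_inter_iff, Set.mem_setOf_eq, mem_connEvent, Set.mem_univ, true_and]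
  constructor
  · rintro ⟨hT, h⟩; exact ⟨hT, (Tp_bK_iff hP hoff hinn ha hb hT).1 h⟩
  · rintro ⟨hT, h⟩; exact ⟨hT, (Tp_bK_iff hP hoff hinn ha hb hT).2 h⟩

/-- `T′ ∩ {b ∈ L} = T′ ∩ {off ∈ univ} ∩ {inn ∈ {u ~ b} ∪ {c ~ b}}`. -/
lemma Tp_bL_eq (hP : ∀ e y z, ends e = s(y, z) → y ∈ P → z ∈ P ∨ z = u ∨ z = a₂ ∨ z = c)
    (hoff : (∀ ω e, e ∈ touches ends P → off ω e = false) ∧ (∀ ω e, e ∉ touches ends P → off ω e = ω e))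
    (hinn : (∀ ω e, e ∈ touches ends P → inn ω e = ω e) ∧ (∀ ω e, e ∉ touches ends P → inn ω e = false))
    (hu : u ∉ P) (hc : c ∉ P) (hb : b ∈ P) :
    TEvent ends a₂ u c ∩ connEvent ends u b =
      TEvent ends a₂ u c ∩ ({ω : Config E | off ω ∈ Set.univ} ∩
        {ω : Config E | inn ω ∈ connEvent ends u b ∪ connEvent ends c b}) := by
  ext ω
  simp only [Set.mem_inter_iff, Set.mem_setOf_eq, mem_connEvent, Set.mem_univ, true_and, Set.mem_union]
  constructor
  · rintro ⟨hT, h⟩; exact ⟨hT, (Tp_bL_iff hP hoff hinn hu hc hb hT).1 h⟩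
  · rintro ⟨hT, h⟩; exact ⟨hT, (Tp_bL_iff hP hoff hinn hu hc hb hT).2 h⟩

/-- `T′ ∩ {o ∈ K, b ∈ K}` (`o ∉ P`). -/
lemma Tp_oK_bK_eq (hP : ∀ e y z, ends e = s(y, z) → y ∈ P → z ∈ P ∨ z = u ∨ z = a₂ ∨ z = c)
    (hoff : (∀ ω e, e ∈ touches ends P → off ω e = false) ∧ (∀ ω e, e ∉ touches ends P → off ω e = ω e))
    (hinn : (∀ ω e, e ∈ touches ends P → inn ω e = ω e) ∧ (∀ ω e, e ∉ touches ends P → inn ω e = false))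
    (ha : a₂ ∉ P) (hb : b ∈ P) {o : V} (ho : o ∉ P) :
    TEvent ends a₂ u c ∩ (connEvent ends a₂ o ∩ connEvent ends a₂ b) =
      TEvent ends a₂ u c ∩ ({ω : Config E | off ω ∈ connEvent ends a₂ o} ∩ {ω : Config E | inn ω ∈ connEvent ends a₂ b}) := by
  ext ω
  simp only [Set.mem_inter_iff, Set.mem_setOf_eq, mem_connEvent]
  constructor
  · rintro ⟨hT, h1, h2⟩
    exact ⟨hT, (Tp_oK_iff hP hoff hinn ha ho hT).1 h1, (Tp_bK_iff hP hoff hinn ha hb hT).1 h2⟩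
  · rintro ⟨hT, h1, h2⟩
    exact ⟨hT, (Tp_oK_iff hP hoff hinn ha ho hT).2 h1, (Tp_bK_iff hP hoff hinn ha hb hT).2 h2⟩

/-- `T′ ∩ {o ∈ K, b ∈ L}` (`o ∉ P`). -/
lemma Tp_oK_bL_eq (hP : ∀ e y z, ends e = s(y, z) → y ∈ P → z ∈ P ∨ z = u ∨ z = a₂ ∨ z = c)
    (hoff : (∀ ω e, e ∈ touches ends P → off ω e = false) ∧ (∀ ω e, e ∉ touches ends P → off ω e = ω e))
    (hinn : (∀ ω e, e ∈ touches ends P → inn ω e = ω e) ∧ (∀ ω e, e ∉ touches ends P → inn ω e = false))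
    (hu : u ∉ P) (ha : a₂ ∉ P) (hc : c ∉ P) (hb : b ∈ P) {o : V} (ho : o ∉ P) :
    TEvent ends a₂ u c ∩ (connEvent ends a₂ o ∩ connEvent ends u b) =
      TEvent ends a₂ u c ∩ ({ω : Config E | off ω ∈ connEvent ends a₂ o} ∩
        {ω : Config E | inn ω ∈ connEvent ends u b ∪ connEvent ends c b}) := by
  ext ω
  simp only [Set.mem_inter_iff, Set.mem_setOf_eq, mem_connEvent, Set.mem_union]
  constructor
  · rintro ⟨hT, h1, h2⟩
    exact ⟨hT, (Tp_oK_iff hP hoff hinn ha ho hT).1 h1, (Tp_bL_iff hP hoff hinn hu hc hb hT).1 h2⟩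
  · rintro ⟨hT, h1, h2⟩
    exact ⟨hT, (Tp_oK_iff hP hoff hinn ha ho hT).2 h1, (Tp_bL_iff hP hoff hinn hu hc hb hT).2 h2⟩


end Tp


end Pocket3

end RootLeafU

end Summit.Ventures.PercRepro2
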